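import Literature.Probability.LatticeModels.PSContourFamilies
import Literature.Probability.LatticeModels.PSCornerEncoding
import Literature.Probability.LatticeModels.PolymerPressure
import HarnessLib

/-!
# Pirogov–Sinai theory, IV: contour weights as a small translation-invariant polymer activity

Topic `Literature/Probability/LatticeModels`. A translation-invariant family of contour weights
`0 ≤ W(γ) ≤ e^{-τ|γ̄|}` on the contours of one type (the `τ`-stable weights of Friedli–Velenik,
§7.4.2, eq. (7.52) without derivatives) is transported to the subset-polymer framework of
`PolymerPressure.lean` through the corner encoding `cs γ̄ = γ̄ + {0,1}^d` (`PSCornerEncoding`):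

* the **merged activity** `ρ̂(B) = Σ_{γ : cs γ̄ = B} W(γ)` (contours with the same encoded support are
  pairwise incompatible), for which the contour polymer partition function in a volume `V`,
  `Σ_{Δ compatible in V} Π W` (FV eq. (7.48)), **equals** the subset-polymer partition function of
  `PolymerGas.lean` in `Vhat V` (`compSum_eq_polymerPartitionFunction`);
* `ρ̂` is a **small translation-invariant activity** in the Kotecký–Preiss form `IsSmallTIActivity`
  (`isSmallTIActivity_rhoHat`) as soon as `Kc · 2^{d+1} 9^d · e^{(1+δ)2^d - τ} ≤ 1`, where `Kc^{|S|}`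
  bounds the number of contours with support `S` — the counting/entropy estimate of FV Lemma 7.30
  (supports are `★`-connected: `★`-lattice animals, `LatticeAnimals.card_connectedFamily_le`).

Everything is proved; no named facts.

## References

* S. Friedli, Y. Velenik, *Statistical Mechanics of Lattice Systems*, CUP 2017, §7.4.2
  (eq. (7.48), Thm. 7.29, Lemma 7.30: τ-stable weights, entropy of contours). [FriedliVelenik2017]
* R. Kotecký, D. Preiss, Comm. Math. Phys. 103 (1986) 491–498. [KoteckyPreiss1986]
-/

noncomputable section

open Finset Relation

namespace Literature.Probability.LatticeModels

variable {d : ℕ}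

/-! ### The corner encoding is nearest-neighbour connected and translation covariant -/

/-- The nearest-neighbour chain relation inside a finite set. [folklore] -/
private abbrev latRel (X : Finset (Site d)) (a b : Site d) : Prop := (zdGraph d).Adj a b ∧ a ∈ X ∧ b ∈ X

/-- Flipping one corner coordinate is a nearest-neighbour step. [folklore] -/
theorem zdGraph_adj_add_update {x a : Site d} {i : Fin d} (ha : a i = 0) :
    (zdGraph d).Adj (x + a) (x + Function.update a i 1) := by
  refine (zdGraph_adj_iff _ _).2 ⟨i, Or.inl (funext fun j => ?_)⟩
  by_cases hj : j = i
  · subst hj; simp [ha]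
  · simp [Function.update_of_ne hj, Pi.single_eq_of_ne hj]

/-- Corners of one cube are chained inside `cs A`. [folklore] -/
theorem reflTransGen_corner {A : Finset (Site d)} {x : Site d} (hx : x ∈ A) {a a' : Site d}
    (ha : a ∈ cube01 d) (ha' : a' ∈ cube01 d) : ReflTransGen (latRel (cs A)) (x + a) (x + a') := by
  suffices key : ∀ (n : ℕ) (b : Site d), b ∈ cube01 d → #(univ.filter fun i => b i ≠ a' i) ≤ n →
      ReflTransGen (latRel (cs A)) (x + b) (x + a') from key d a ha ((card_filter_le _ _).trans (by simp))
  intro n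
  induction n with
  | zero =>
    intro b hb hn
    have : b = a' := funext fun i => by
      by_contra hi
      have : 0 < #(univ.filter fun i => b i ≠ a' i) := card_pos.2 ⟨i, mem_filter.2 ⟨mem_univ i, hi⟩⟩
      omega
    subst this
    exact ReflTransGen.refl
  | succ n ih =>
    intro b hb hn
    by_cases hall : ∀ i, b i = a' i
    · rw [show b = a' from funext hall]
    · push Not at hall
      obtain ⟨i, hi⟩ := hall
      set b' := Function.update b i (a' i) with hb'
      have hb'c : b' ∈ cube01 d := mem_cube01.2 fun j => by
        by_cases hj : j = i
        · subst hj; rw [hb', Function.update_self]; exact mem_cube01.1 ha' j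
        · rw [hb', Function.update_of_ne hj]; exact mem_cube01.1 hb j
      have hstep : ReflTransGen (latRel (cs A)) (x + b) (x + b') := by
        refine ReflTransGen.single ⟨?_, mem_cs.2 ⟨x, hx, b, hb, rfl⟩, mem_cs.2 ⟨x, hx, b', hb'c, rfl⟩⟩
        rcases mem_cube01.1 hb i with h0 | h1 <;> rcases mem_cube01.1 ha' i with h0' | h1'
        · exact absurd (h0.trans h0'.symm) hi
        · have : b' = Function.update b i 1 := by rw [hb', h1']
          rw [this]; exact zdGraph_adj_add_update h0
        · have hb'0 : b' i = 0 := by rw [hb', Function.update_self, h0']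
          have : b = Function.update b' i 1 := by
            rw [hb', Function.update_idem, ← h1, Function.update_eq_self]
          rw [this]; exact (zdGraph_adj_add_update hb'0).symm
        · exact absurd (h1.trans h1'.symm) hi
      refine hstep.trans (ih b' hb'c ?_)
      have hset : (univ.filter fun j => b' j ≠ a' j) = (univ.filter fun j => b j ≠ a' j).erase i := by
        ext j
        simp only [mem_filter, mem_univ, true_and, mem_erase]
        by_cases hj : j = i
        · subst hj; simp [hb']
        · rw [hb', Function.update_of_ne hj]; tauto
      rw [hset, card_erase_of_mem (mem_filter.2 ⟨mem_univ i, hi⟩)]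
      omega

/-- **The corner encoding of a `★`-connected set is nearest-neighbour connected.**
[cite: FriedliVelenik2017, §7.3 (remark after eq. (7.34))] -/
theorem isRConnected_cs {A : Finset (Site d)} (hne : A.Nonempty) (hconn : StarConn (A : Set (Site d))) :
    IsRConnected (zdGraph d).Adj (cs A) := by
  refine ⟨cs_nonempty hne, fun v hv w hw => ?_⟩
  obtain ⟨x, hx, a, ha, rfl⟩ := mem_cs.1 hv
  obtain ⟨y, hy, b, hb, rfl⟩ := mem_cs.1 hw
  -- along a `★`-chain from `x` to `y` inside `A`, the base corners are chained in `cs A`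
  have key : ∀ z, ReflTransGen (starRel (A : Set (Site d))) x z → ReflTransGen (latRel (cs A)) (x + 0) (z + 0) := by
    intro z hz
    induction hz with
    | refl => exact ReflTransGen.refl
    | @tail u z _ huz ih =>
      obtain ⟨c, hc, e, he, hce⟩ := supDist_le_one_iff_exists_corner.1 (zdStar_adj.1 huz.1).2
      have hu : u ∈ A := mem_coe.1 huz.2.1
      have hz : z ∈ A := mem_coe.1 huz.2.2
      exact (ih.trans (reflTransGen_corner hu (zero_mem_cube01 d) hc)).trans
        (hce ▸ reflTransGen_corner hz he (zero_mem_cube01 d))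
  exact ((reflTransGen_corner hx ha (zero_mem_cube01 d)).trans (key y (hconn x (mem_coe.2 hx) y (mem_coe.2 hy)))).trans
    (reflTransGen_corner hy (zero_mem_cube01 d) hb)

/-- The corner encoding commutes with translations. [folklore] -/
theorem cs_shiftSet (v : Site d) (A : Finset (Site d)) : cs (shiftSet v A) = shiftSet v (cs A) := by
  ext y
  rw [mem_cs, mem_shiftSet, mem_cs]
  constructor
  · rintro ⟨x, hx, a, ha, rfl⟩
    exact ⟨x - v, mem_shiftSet.1 hx, a, ha, by abel⟩
  · rintro ⟨x, hx, a, ha, h⟩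
    exact ⟨x + v, mem_shiftSet.2 (by simpa using hx), a, ha, by rw [sub_eq_iff_eq_add.1 h]; abel⟩

/-! ### Translations of contours -/

namespace ContourSetup

/-- **A translation action on a contour setup**: lattice translations act on contours, moving
supports and preserving types (translation invariance of the contour weights, FV §7.4.2).
[cite: FriedliVelenik2017, §7.4.2 (𝒞 and w translation invariant)] -/
structure Shift (S : ContourSetup d) where
  /-- translating a contour by `v` -/
  shift : Site d → S.Γ → S.Γ
  /-- the support is translated -/
  supp_shift : ∀ v γ, S.supp (shift v γ) = shiftSet v (S.supp γ)
  /-- the type is preserved -/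
  type_shift : ∀ v γ, S.type (shift v γ) = S.type γ
  /-- translating by `0` does nothing -/
  shift_zero : ∀ γ, shift 0 γ = γ
  /-- translations compose -/
  shift_add : ∀ u v γ, shift (u + v) γ = shift u (shift v γ)

variable {S : ContourSetup d}

/-- Translating by `-v` undoes translating by `v`. [folklore] -/
theorem Shift.shift_neg_shift (T : S.Shift) (v : Site d) (γ : S.Γ) : T.shift (-v) (T.shift v γ) = γ := by
  rw [← T.shift_add, neg_add_cancel, T.shift_zero]

/-- Translating by `v` undoes translating by `-v`. [folklore] -/
theorem Shift.shift_shift_neg (T : S.Shift) (v : Site d) (γ : S.Γ) : T.shift v (T.shift (-v) γ) = γ := by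
  rw [← T.shift_add, add_neg_cancel, T.shift_zero]

/-! ### The merged activity on encoded supports -/

variable (S) in
/-- The contours of type `σ` with encoded support `B`. [folklore] -/
def fibCs (σ : Phase) (B : Finset (Site d)) : Finset S.Γ :=
  (B.powerset.biUnion S.withSupp).filter fun γ => S.type γ = σ ∧ cs (S.supp γ) = B

/-- Membership in `fibCs`. [folklore] -/
theorem mem_fibCs {σ : Phase} {B : Finset (Site d)} {γ : S.Γ} : γ ∈ S.fibCs σ B ↔ S.type γ = σ ∧ cs (S.supp γ) = B := by
  rw [fibCs, mem_filter, mem_biUnion]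
  exact ⟨fun h => h.2, fun h => ⟨⟨S.supp γ, mem_powerset.2 (h.2 ▸ subset_cs _), (S.mem_withSupp _ _).2 rfl⟩, h⟩⟩

/-- Fibres over distinct encoded supports are disjoint. [folklore] -/
theorem disjoint_fibCs {σ : Phase} {B B' : Finset (Site d)} (h : B ≠ B') : Disjoint (S.fibCs σ B) (S.fibCs σ B') :=
  Finset.disjoint_left.2 fun _ hγ hγ' => h ((mem_fibCs.1 hγ).2.symm.trans (mem_fibCs.1 hγ').2)

variable (S) in
/-- **The merged activity** `ρ̂(B) = Σ_{γ of type σ : cs γ̄ = B} W(γ)` on subset polymers.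
[cite: FriedliVelenik2017, §7.4.2, eq. (7.48) (with the remark after eq. (7.34))] -/
def rhoHat (σ : Phase) (W : S.Γ → ℝ) (B : Finset (Site d)) : ℂ := ((∑ γ ∈ S.fibCs σ B, W γ : ℝ) : ℂ)

variable (S) in
/-- **The contour polymer partition function** `Ξ(V) = Σ_{Δ compatible family of type σ in V} Π_{δ ∈ Δ} W(δ)`.
[cite: FriedliVelenik2017, §7.4.2, eq. (7.48)] -/
def compSum (σ : Phase) (W : S.Γ → ℝ) (V : Finset (Site d)) : ℝ := ∑ Δ ∈ S.CompFam σ V, ∏ δ ∈ Δ, W δ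

/-- `rhoHat` as a real number. [folklore] -/
theorem rhoHat_eq (σ : Phase) (W : S.Γ → ℝ) (B : Finset (Site d)) :
    S.rhoHat σ W B = ((∑ γ ∈ S.fibCs σ B, W γ : ℝ) : ℂ) := rfl

/-- **The contour polymer partition function is the subset-polymer partition function of the merged
activity** in the shrunk volume `Vhat V` (contours with equal encoded supports are incompatible, so
compatible families choose at most one contour per encoded support).
[cite: FriedliVelenik2017, §7.3 (remark after eq. (7.34)) and §7.4.2, eq. (7.48)] -/
theorem compSum_eq_polymerPartitionFunction (σ : Phase) (W : S.Γ → ℝ) (V : Finset (Site d)) :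
    (S.compSum σ W V : ℂ) = polymerPartitionFunction polyInc (S.rhoHat σ W) (Vhat V).powerset := by
  classical
  -- group the compatible families by their family of encoded supports
  set g : Finset S.Γ → Finset (Finset (Site d)) := fun Δ => Δ.image fun γ => cs (S.supp γ) with hg
  have hmaps : ∀ Δ ∈ S.CompFam σ V, g Δ ∈ (Vhat V).powerset.powerset := by
    intro Δ hΔ
    rw [mem_powerset]
    intro B hB
    obtain ⟨γ, hγ, rfl⟩ := mem_image.1 hB
    exact mem_powerset.2 (inVol_iff_cs_subset.1 ((mem_compFam.1 hΔ).1 γ hγ).2)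
  rw [compSum, polymerPartitionFunction]
  push_cast
  rw [← sum_fiberwise_of_maps_to hmaps]
  refine sum_congr rfl fun 𝒜 h𝒜 => ?_
  -- the fibre over `𝒜`
  by_cases hcomp : IsCompatible polyInc 𝒜
  swap
  · -- no compatible family has an incompatible family of encoded supports
    rw [if_neg hcomp]
    refine sum_eq_zero fun Δ hΔ => ?_
    exfalso
    obtain ⟨hΔ, hgΔ⟩ := mem_filter.1 hΔ
    apply hcomp
    rw [← hgΔ]
    intro B hB B' hB' hne hinc
    obtain ⟨γ, hγ, rfl⟩ := mem_image.1 (mem_coe.1 hB)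
    obtain ⟨γ', hγ', rfl⟩ := mem_image.1 (mem_coe.1 hB')
    have hγγ' : γ ≠ γ' := fun h => hne (h ▸ rfl)
    have hc := (mem_compFam.1 hΔ).2 (mem_coe.2 hγ) (mem_coe.2 hγ') hγγ'
    rw [compat_iff_disjoint_cs] at hc
    rcases hinc with h | h
    · exact hne h
    · exact (disjoint_iff_inter_eq_empty.1 hc ▸ h).ne_empty rfl
  rw [if_pos hcomp]
  -- slots: one contour of the fibre per encoded support
  obtain ⟨hgen, hinj⟩ := prod_sum_prod_eq_sum_image_slotUnion 𝒜 (fun B => (S.fibCs σ B).image fun γ => ({γ} : Finset S.Γ))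
    (fun B => S.fibCs σ B) (fun B _ Δ hΔ => by obtain ⟨γ, hγ, rfl⟩ := mem_image.1 hΔ; exact singleton_subset_iff.2 hγ)
    (fun B _ B' _ h => disjoint_fibCs h) (fun γ => (W γ : ℂ))
  have hlhs : ∏ B ∈ 𝒜, S.rhoHat σ W B = ∏ B ∈ 𝒜, ∑ Δ ∈ (S.fibCs σ B).image (fun γ => ({γ} : Finset S.Γ)), ∏ a ∈ Δ, (W a : ℂ) := by
    refine prod_congr rfl fun B _ => ?_
    rw [rhoHat_eq]; push_cast
    rw [sum_image fun γ _ γ' _ h => singleton_injective h]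
    simp
  rw [hlhs, hgen]
  -- the fibre is the image of the glued choices
  have hfib : (S.CompFam σ V).filter (fun Δ => g Δ = 𝒜) =
      (𝒜.pi fun B => (S.fibCs σ B).image fun γ => ({γ} : Finset S.Γ)).image (slotUnion 𝒜) := by
    ext Δ
    rw [mem_filter, mem_image]
    constructor
    · rintro ⟨hΔ, hgΔ⟩
      -- the choice: the member with a given encoded support
      refine ⟨fun B hB => Δ.filter fun γ => cs (S.supp γ) = B, mem_pi.2 fun B hB => ?_, ?_⟩
      · rw [← hgΔ] at hB
        obtain ⟨γ, hγ, rfl⟩ := mem_image.1 hB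
        refine mem_image.2 ⟨γ, mem_fibCs.2 ⟨((mem_compFam.1 hΔ).1 γ hγ).1, rfl⟩, ?_⟩
        symm
        refine eq_singleton_iff_unique_mem.2 ⟨mem_filter.2 ⟨hγ, rfl⟩, fun γ' hγ' => ?_⟩
        obtain ⟨hγ'Δ, hcs⟩ := mem_filter.1 hγ'
        by_contra hne
        have hc := (mem_compFam.1 hΔ).2 (mem_coe.2 hγ'Δ) (mem_coe.2 hγ) hne
        rw [compat_iff_disjoint_cs, hcs, disjoint_self, bot_eq_empty] at hc
        exact (cs_nonempty (S.supp_nonempty γ)).ne_empty hc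
      · ext γ
        rw [mem_slotUnion]
        constructor
        · rintro ⟨B, hB, hγ⟩; exact (mem_filter.1 hγ).1
        · intro hγ
          exact ⟨cs (S.supp γ), hgΔ ▸ mem_image_of_mem _ hγ, mem_filter.2 ⟨hγ, rfl⟩⟩
    · rintro ⟨p, hp, rfl⟩
      rw [mem_pi] at hp
      -- each chosen family is a singleton of the right fibre
      have hsing : ∀ B (hB : B ∈ 𝒜), ∃ γ ∈ S.fibCs σ B, p B hB = {γ} := fun B hB => by
        obtain ⟨γ, hγ, h⟩ := mem_image.1 (hp B hB); exact ⟨γ, hγ, h.symm⟩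
      have hmem : ∀ γ ∈ slotUnion 𝒜 p, ∃ B ∈ 𝒜, γ ∈ S.fibCs σ B := fun γ hγ => by
        obtain ⟨B, hB, hγB⟩ := mem_slotUnion.1 hγ
        obtain ⟨γ', hγ', hpB⟩ := hsing B hB
        rw [hpB, mem_singleton] at hγB
        exact ⟨B, hB, hγB ▸ hγ'⟩
      have h𝒜V : 𝒜 ⊆ (Vhat V).powerset := mem_powerset.1 h𝒜
      constructor
      · refine mem_compFam.2 ⟨fun γ hγ => ?_, fun γ hγ γ' hγ' hne => ?_⟩
        · obtain ⟨B, hB, hγB⟩ := hmem γ hγ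
          obtain ⟨ht, hcs⟩ := mem_fibCs.1 hγB
          exact ⟨ht, inVol_iff_cs_subset.2 (hcs ▸ mem_powerset.1 (h𝒜V hB))⟩
        · obtain ⟨B, hB, hγB⟩ := hmem γ (mem_coe.1 hγ)
          obtain ⟨B', hB', hγB'⟩ := hmem γ' (mem_coe.1 hγ')
          rw [compat_iff_disjoint_cs, (mem_fibCs.1 hγB).2, (mem_fibCs.1 hγB').2]
          have hBB' : B ≠ B' := by
            intro h
            subst h
            obtain ⟨γ₀, -, hpB⟩ := hsing B hB
            obtain ⟨B₁, hB₁, hγ₁⟩ := mem_slotUnion.1 (mem_coe.1 hγ)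
            obtain ⟨B₂, hB₂, hγ₂⟩ := mem_slotUnion.1 (mem_coe.1 hγ')
            -- `γ, γ'` both lie in the slot of `B`
            have key : ∀ (B₃ : Finset (Site d)) (hB₃ : B₃ ∈ 𝒜) (δ : S.Γ), δ ∈ p B₃ hB₃ → δ ∈ S.fibCs σ B → δ = γ₀ := by
              intro B₃ hB₃ δ hδ hδB
              obtain ⟨γ₃, hγ₃, hpB₃⟩ := hsing B₃ hB₃
              rw [hpB₃, mem_singleton] at hδ
              subst hδ
              have : B₃ = B := (mem_fibCs.1 hγ₃).2.symm.trans (mem_fibCs.1 hδB).2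
              subst this
              have := hpB₃.symm.trans hpB
              exact singleton_injective this
            exact hne ((key B₁ hB₁ γ hγ₁ hγB).trans (key B₂ hB₂ γ' hγ₂ hγB').symm)
          rcases hcomp (mem_coe.2 hB) (mem_coe.2 hB') hBB' |> fun h => h with h
          rw [polyInc, not_or, not_nonempty_iff_eq_empty] at h
          exact disjoint_iff_inter_eq_empty.2 h.2
      · -- the encoded supports of the glued family are `𝒜`
        ext B
        rw [hg, mem_image]
        constructor
        · rintro ⟨γ, hγ, rfl⟩
          obtain ⟨B', hB', hγB'⟩ := hmem γ hγ
          exact (mem_fibCs.1 hγB').2 ▸ hB'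
        · intro hB
          obtain ⟨γ, hγ, hpB⟩ := hsing B hB
          exact ⟨γ, mem_slotUnion.2 ⟨B, hB, by rw [hpB]; exact mem_singleton_self γ⟩, (mem_fibCs.1 hγ).2⟩
  rw [hfib, sum_image hinj]

/-! ### Smallness of the merged activity (entropy of contours) -/

/-- The number of `★`-connected sets of size `k ≥ 1` containing a given point in a finite family
is at most `(3^d)^{2(k-1)}`. [cite: FriedliVelenik2017, Lemma 7.30 (proof: #{γ̄ ∋ 0, |γ̄| = k} ≤ e^{ck})] -/
theorem card_filter_starConn_le (v : Site d) (k : ℕ) (𝒮 : Finset (Finset (Site d)))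
    (h𝒮 : ∀ A ∈ 𝒮, v ∈ A ∧ #A = k ∧ StarConn (A : Set (Site d))) : #𝒮 ≤ (3 ^ d) ^ (2 * (k - 1)) := by
  classical
  have h3 : 3 ^ d - 1 + 1 = 3 ^ d := Nat.sub_add_cancel (Nat.one_le_pow _ _ (by norm_num))
  rw [← h3]
  refine card_connectedFamily_le (R := (zdStar d).Adj) (nbr := fun x => (starBall x).erase x) (fun x y h => h.symm)
    (fun x => ?_) (fun x y h => mem_erase.2 ⟨(zdStar_adj.1 h).1.symm, (adj_iff_mem_starBall.1 h).1⟩) v (k - 1) 𝒮 fun A hA => ?_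
  · rw [card_erase_of_mem (mem_starBall_self x), card_starBall]
  · obtain ⟨hv, hcard, hconn⟩ := h𝒮 A hA
    refine ⟨hv, by omega, fun w hw => ?_⟩
    exact hconn v (mem_coe.2 hv) w (mem_coe.2 hw)

/-- **The merged activity of `τ`-stable translation-invariant contour weights is a small
translation-invariant activity** (Kotecký–Preiss form), provided
`Kc · 2^{d+1} 9^d · e^{(1+δ)2^d - τ} ≤ 1` where `#{γ : supp γ = S} ≤ Kc^{|S|}`.
[cite: FriedliVelenik2017, §7.4.2, Thm. 7.29 with Lemma 7.30 (eqs. (7.56)–(7.58))] -/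
theorem isSmallTIActivity_rhoHat (T : S.Shift) {σ : Phase} {W : S.Γ → ℝ} {τ δ : ℝ} {Kc : ℕ}
    (hW0 : ∀ γ, 0 ≤ W γ) (hWτ : ∀ γ, S.type γ = σ → W γ ≤ Real.exp (-τ * S.size γ))
    (hWT : ∀ v γ, W (T.shift v γ) = W γ) (hKc : ∀ A, #(S.withSupp A) ≤ Kc ^ #A) (hδ : 0 < δ)
    (hsmall : (Kc : ℝ) * (2 ^ (d + 1) * 9 ^ d) * Real.exp ((1 + δ) * 2 ^ d - τ) ≤ 1) :
    IsSmallTIActivity (S.rhoHat σ W) δ where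
  shift_invariant v A := by
    rw [rhoHat_eq, rhoHat_eq]
    norm_cast
    -- `γ ↦ shift (-v) γ` is a bijection from the fibre of `A + v` to the fibre of `A`
    refine Finset.sum_nbij' (fun γ => T.shift (-v) γ) (fun γ => T.shift v γ) (fun γ hγ => ?_) (fun γ hγ => ?_)
      (fun γ _ => T.shift_shift_neg v γ) (fun γ _ => T.shift_neg_shift v γ) (fun γ _ => (hWT (-v) γ).symm)
    · obtain ⟨ht, hcs⟩ := mem_fibCs.1 (mem_coe.1 hγ)
      refine mem_coe.2 (mem_fibCs.2 ⟨by rw [T.type_shift, ht], ?_⟩)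
      rw [T.supp_shift, cs_shiftSet, hcs, IsSmallTIActivity.shiftSet_shiftSet, add_neg_cancel, IsSmallTIActivity.shiftSet_zero]
    · obtain ⟨ht, hcs⟩ := mem_fibCs.1 (mem_coe.1 hγ)
      exact mem_coe.2 (mem_fibCs.2 ⟨by rw [T.type_shift, ht], by rw [T.supp_shift, cs_shiftSet, hcs]⟩)
  eq_zero_of_not_isRConnected A hA := by
    rw [rhoHat_eq]
    norm_cast
    refine sum_eq_zero fun γ hγ => ?_
    exfalso
    obtain ⟨-, hcs⟩ := mem_fibCs.1 hγ
    exact hA (hcs ▸ isRConnected_cs (S.supp_nonempty γ) (S.supp_starConn γ))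
  delta_pos := hδ
  sum_le_one x 𝒜 h𝒜 := by
    classical
    have hδ1 : 0 ≤ 1 + δ := by linarith
    -- the contours behind the family
    set 𝒢 : Finset S.Γ := 𝒜.biUnion (S.fibCs σ) with h𝒢
    set θ₁ : ℝ := Real.exp ((1 + δ) * 2 ^ d - τ) with hθ₁
    set θ : ℝ := Kc * θ₁ with hθ
    have hθ₁0 : 0 ≤ θ₁ := Real.exp_nonneg _
    have hθ0 : 0 ≤ θ := mul_nonneg (Nat.cast_nonneg _) hθ₁0
    -- Step 1: pass to contours
    have step1 : ∑ A ∈ 𝒜, ‖S.rhoHat σ W A‖ * Real.exp ((1 + δ) * (A.card : ℝ)) ≤ ∑ γ ∈ 𝒢, θ₁ ^ S.size γ := by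
      calc ∑ A ∈ 𝒜, ‖S.rhoHat σ W A‖ * Real.exp ((1 + δ) * (A.card : ℝ))
          ≤ ∑ A ∈ 𝒜, ∑ γ ∈ S.fibCs σ A, W γ * Real.exp ((1 + δ) * 2 ^ d * S.size γ) := by
            refine sum_le_sum fun A hA => ?_
            rw [rhoHat_eq, Complex.norm_real, Real.norm_of_nonneg (sum_nonneg fun γ _ => hW0 γ), sum_mul]
            refine sum_le_sum fun γ hγ => mul_le_mul_of_nonneg_left (Real.exp_le_exp.2 ?_) (hW0 γ)
            rw [mul_assoc]
            refine mul_le_mul_of_nonneg_left ?_ hδ1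
            rw [← (mem_fibCs.1 hγ).2]
            exact_mod_cast card_cs_le (S.supp γ)
        _ = ∑ γ ∈ 𝒢, W γ * Real.exp ((1 + δ) * 2 ^ d * S.size γ) := by
            rw [h𝒢, sum_biUnion fun A _ A' _ h => disjoint_fibCs h]
        _ ≤ ∑ γ ∈ 𝒢, θ₁ ^ S.size γ := by
            refine sum_le_sum fun γ hγ => ?_
            obtain ⟨A, -, hγA⟩ := mem_biUnion.1 hγ
            have ht := (mem_fibCs.1 hγA).1
            calc W γ * Real.exp ((1 + δ) * 2 ^ d * S.size γ)
                ≤ Real.exp (-τ * S.size γ) * Real.exp ((1 + δ) * 2 ^ d * S.size γ) :=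
                  mul_le_mul_of_nonneg_right (hWτ γ ht) (Real.exp_nonneg _)
              _ = θ₁ ^ S.size γ := by rw [← Real.exp_add, hθ₁, ← Real.exp_nat_mul]; ring_nf
    -- Step 2: group by supports
    set 𝒮 : Finset (Finset (Site d)) := 𝒢.image S.supp with h𝒮
    have step2 : ∑ γ ∈ 𝒢, θ₁ ^ S.size γ ≤ ∑ A ∈ 𝒮, θ ^ #A := by
      rw [← sum_fiberwise_of_maps_to (g := S.supp) (fun γ hγ => mem_image_of_mem _ hγ)]
      refine sum_le_sum fun A hA => ?_
      calc ∑ γ ∈ 𝒢 with S.supp γ = A, θ₁ ^ S.size γ = ∑ γ ∈ 𝒢 with S.supp γ = A, θ₁ ^ #A :=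
            sum_congr rfl fun γ hγ => by rw [ContourSetup.size, (mem_filter.1 hγ).2]
        _ = #(𝒢.filter fun γ => S.supp γ = A) * θ₁ ^ #A := by rw [sum_const, nsmul_eq_mul]
        _ ≤ (Kc : ℝ) ^ #A * θ₁ ^ #A := by
            refine mul_le_mul_of_nonneg_right ?_ (pow_nonneg hθ₁0 _)
            have : #(𝒢.filter fun γ => S.supp γ = A) ≤ Kc ^ #A :=
              (card_le_card fun γ hγ => (S.mem_withSupp _ _).2 (mem_filter.1 hγ).2).trans (hKc A)
            exact_mod_cast this
        _ = θ ^ #A := by rw [hθ, mul_pow]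
    -- Step 3: the supports are `★`-connected and meet `x - a` for some corner `a`
    have h𝒮 : ∀ A ∈ 𝒮, StarConn (A : Set (Site d)) ∧ A.Nonempty ∧ ∃ a ∈ cube01 d, x - a ∈ A := by
      intro A hA
      obtain ⟨γ, hγ, rfl⟩ := mem_image.1 hA
      obtain ⟨B, hB, hγB⟩ := mem_biUnion.1 hγ
      refine ⟨S.supp_starConn γ, S.supp_nonempty γ, ?_⟩
      have hx : x ∈ cs (S.supp γ) := (mem_fibCs.1 hγB).2 ▸ h𝒜 B hB
      obtain ⟨y, hy, a, ha, rfl⟩ := mem_cs.1 hx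
      exact ⟨a, ha, by simpa using hy⟩
    have step3 : ∑ A ∈ 𝒮, θ ^ #A ≤ ∑ a ∈ cube01 d, ∑ A ∈ 𝒮 with x - a ∈ A, θ ^ #A := by
      calc ∑ A ∈ 𝒮, θ ^ #A ≤ ∑ A ∈ 𝒮, ∑ a ∈ cube01 d with x - a ∈ A, θ ^ #A := by
            refine sum_le_sum fun A hA => ?_
            obtain ⟨-, -, a, ha, hxa⟩ := h𝒮 A hA
            rw [sum_const, nsmul_eq_mul]
            refine le_mul_of_one_le_left (pow_nonneg hθ0 _) ?_
            exact_mod_cast card_pos.2 ⟨a, mem_filter.2 ⟨ha, hxa⟩⟩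
        _ = ∑ a ∈ cube01 d, ∑ A ∈ 𝒮 with x - a ∈ A, θ ^ #A := by
            simp only [sum_filter]
            exact sum_comm
    -- the two smallness consequences of `hsmall`
    have h9 : (1 : ℝ) ≤ 9 ^ d := one_le_pow₀ (by norm_num)
    have h2 : (1 : ℝ) ≤ 2 ^ (d + 1) := one_le_pow₀ (by norm_num)
    have hθ9 : θ * 9 ^ d ≤ 1 / 2 := by
      have h1 : θ * 9 ^ d * 2 ^ (d + 1) ≤ 1 := by
        calc θ * 9 ^ d * 2 ^ (d + 1) = (Kc : ℝ) * (2 ^ (d + 1) * 9 ^ d) * θ₁ := by rw [hθ]; ring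
          _ ≤ 1 := hsmall
      have h22 : (2 : ℝ) ≤ 2 ^ (d + 1) := by
        calc (2 : ℝ) = 2 ^ 1 := by norm_num
          _ ≤ 2 ^ (d + 1) := pow_le_pow_right₀ (by norm_num) (by omega)
      rw [le_div_iff₀ (by norm_num : (0 : ℝ) < 2)]
      nlinarith [mul_nonneg hθ0 (le_trans zero_le_one h9)]
    have hθ2 : 2 ^ (d + 1) * θ ≤ 1 := by
      calc 2 ^ (d + 1) * θ ≤ 2 ^ (d + 1) * θ * 9 ^ d := le_mul_of_one_le_right (by positivity) h9
        _ = (Kc : ℝ) * (2 ^ (d + 1) * 9 ^ d) * θ₁ := by rw [hθ]; ring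
        _ ≤ 1 := hsmall
    -- Step 4: for a fixed corner, count `★`-animals by size
    have step4 : ∀ a ∈ cube01 d, ∑ A ∈ 𝒮 with x - a ∈ A, θ ^ #A ≤ 2 * θ := by
      intro a _
      set v := x - a with hv
      set 𝒮a := 𝒮.filter fun A => v ∈ A with h𝒮a
      set K := 𝒮a.sup card with hK
      -- group by size
      have hgroup : ∑ A ∈ 𝒮a, θ ^ #A = ∑ k ∈ range (K + 1), #(𝒮a.filter fun A => #A = k) * θ ^ k := by
        rw [← sum_fiberwise_of_maps_to (g := card) (t := range (K + 1))
          (fun A hA => mem_range.2 (Nat.lt_succ_of_le (le_sup (f := card) hA)))]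
        refine sum_congr rfl fun k _ => ?_
        rw [sum_congr rfl fun A hA => by rw [(mem_filter.1 hA).2], sum_const, nsmul_eq_mul]
      -- the size classes: empty for `k = 0`, `★`-animals for `k ≥ 1`
      have hclass : ∀ k, #(𝒮a.filter fun A => #A = k) * θ ^ k ≤ if k = 0 then 0 else θ * (1 / 2) ^ (k - 1) := by
        intro k
        split_ifs with hk
        · subst hk
          have : 𝒮a.filter (fun A => #A = 0) = ∅ := by
            refine filter_eq_empty_iff.2 fun A hA h0 => ?_
            rw [card_eq_zero] at h0
            exact notMem_empty v (h0 ▸ (mem_filter.1 hA).2)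
          rw [this, card_empty, Nat.cast_zero, zero_mul]
        · have hcount : #(𝒮a.filter fun A => #A = k) ≤ (3 ^ d) ^ (2 * (k - 1)) :=
            card_filter_starConn_le v k _ fun A hA => by
              obtain ⟨hA𝒮a, hAk⟩ := mem_filter.1 hA
              obtain ⟨hA𝒮, hvA⟩ := mem_filter.1 hA𝒮a
              exact ⟨hvA, hAk, (h𝒮 A hA𝒮).1⟩
          calc (#(𝒮a.filter fun A => #A = k) : ℝ) * θ ^ k ≤ ((3 : ℝ) ^ d) ^ (2 * (k - 1)) * θ ^ k := by
                refine mul_le_mul_of_nonneg_right ?_ (pow_nonneg hθ0 _)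
                exact_mod_cast hcount
            _ = θ * (9 ^ d * θ) ^ (k - 1) := by
                have e1 : ((3 : ℝ) ^ d) ^ (2 * (k - 1)) = (9 ^ d) ^ (k - 1) := by
                  rw [← pow_mul, show d * (2 * (k - 1)) = 2 * (d * (k - 1)) by ring, pow_mul, pow_mul]
                  norm_num
                have e2 : θ ^ k = θ * θ ^ (k - 1) := by
                  rw [← pow_succ']; congr 1; omega
                rw [e1, e2]; ring
            _ ≤ θ * (1 / 2) ^ (k - 1) := by
                refine mul_le_mul_of_nonneg_left (pow_le_pow_left₀ (by positivity) ?_ _) hθ0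
                rw [mul_comm]; exact hθ9
      rw [hgroup]
      calc ∑ k ∈ range (K + 1), (#(𝒮a.filter fun A => #A = k) : ℝ) * θ ^ k
          ≤ ∑ k ∈ range (K + 1), (if k = 0 then (0 : ℝ) else θ * (1 / 2) ^ (k - 1)) := sum_le_sum fun k _ => hclass k
        _ = ∑ j ∈ range K, θ * (1 / 2) ^ j := by
            rw [sum_range_succ']
            simp only [Nat.succ_ne_zero, ↓reduceIte, Nat.add_sub_cancel, add_zero]
        _ = θ * ∑ j ∈ range K, (1 / 2 : ℝ) ^ j := by rw [mul_sum]
        _ ≤ θ * 2 := by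
            refine mul_le_mul_of_nonneg_left ?_ hθ0
            rw [geom_sum_eq (by norm_num : (1 / 2 : ℝ) ≠ 1)]
            have : (0 : ℝ) ≤ (1 / 2) ^ K := by positivity
            rw [div_le_iff_of_neg (by norm_num)]
            linarith
        _ = 2 * θ := mul_comm _ _
    -- Step 5: add up the corners
    calc ∑ A ∈ 𝒜, ‖S.rhoHat σ W A‖ * Real.exp ((1 + δ) * (A.card : ℝ)) ≤ ∑ A ∈ 𝒮, θ ^ #A := step1.trans step2
      _ ≤ ∑ a ∈ cube01 d, ∑ A ∈ 𝒮 with x - a ∈ A, θ ^ #A := step3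
      _ ≤ ∑ a ∈ cube01 d, 2 * θ := sum_le_sum step4
      _ = 2 ^ (d + 1) * θ := by rw [sum_const, card_cube01, nsmul_eq_mul]; push_cast; ring
      _ ≤ 1 := hθ2

end ContourSetup

end Literature.Probability.LatticeModels

end
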